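import Mathlib
import Summits.ResolutionOfSingularities.ResolutionOfSingularities.Theorems.RadicialJungCleanModelsCleanProp44SigmaTower
import Summits.ResolutionOfSingularities.ResolutionOfSingularities.Theorems.RadicialJungCleanModelsCleanProp44ChartPointStep
import Summits.ResolutionOfSingularities.ResolutionOfSingularities.Theorems.RadicialJungCleanModelsCleanProp44ChartLocalization
import HarnessLib

/-!
# Route `RadicialJung`, crux `CleanModels` (stmt-ResolutionOfSingularities-15917), line `Sketch` rev 35, stub 6 `stub_cleanProp44` (X44c):
# THE σ-TOWER CHAINED — ITS TWO ENDS: the level-`0` inputs from the point blow-up, and the top read as `IsLocalization.AtPrime` at the births and at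
# the generic point of the near curve (⟹ ✓ `birth_descent_of_isLocalization` / ✓ `exists_successor_of_isLocalization`)

Seat decomp-res-hand-2 g23 (structural hand); sequel of ✓ `…SigmaTower` (`sigmaTower_step`, `sigmaTower`).  The chained tower consumes at level `0` a part
`(t_0, v_0)` of a regular system of parameters of `𝒪_{X_1, z_1}` and a `K`-structure on `D_0 = 𝒪_{X_1,z_1}/(t_0, v_0)` which is a localization at `M₀`, and
returns at every level a `K[T]`-localization statement for the exceptional divisor.  This file closes both ends:

* §1 `sigmaTower_base` — **THE BASE** from the point blow-up (✓ `exists_pointStep_of_isBlowup` + ✓ `isRsopPart_pair_of_isBlowup`), transported along a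
  ring isomorphism `e : 𝒪_{X_1,x′} ≅ A₀` onto the bottom stalk of the first curve blow-up: chart index `i ≠ 0`, free index `i₂`, fractions `uf`,
  `IsRsopPart ![e uf_0, e π♯cᵢ]` (`t_0 = e(t/uᵢ)`, `v_0 = e(π♯uᵢ)`), and: every `K[X]`-structure on `A₀/(t_0, v_0)` with `C g ↦ class of e π♯r`
  (`r̄ = g` in `κ(c)`), `X ↦ class of e uf_{i₂}` is a localization of `K[X]` at some submonoid — the `hloc₀` of ✓ `sigmaTower` with `K ↝ K[X] = κ(c)[u]`.
* §2 `atPrime_span_pair_of_exists_isLocalization` / `exists_prime_atPrime_of_exists_isLocalization` — **THE TOP**: the `∃ N, IsLocalization N S` clause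
  of ✓ `sigmaTower` at a point of the exceptional divisor, plus `P(u), T + λ ∈ 𝔫_S` (a birth `c′ ∈ Γ″`, census (S4)) resp. «non-zero `g(u)` are units and
  `𝔫_S ∩ κ[u][T] ≠ 0`» (the generic point `η″` of `Γ″`), IS the `IsLocalization.AtPrime` statement ✓ `birth_descent_of_isLocalization` /
  ✓ `exists_successor_of_isLocalization` consume; `birth_descent_of_exists_isLocalization` and `exists_successor_of_exists_isLocalization` are these two
  compositions with the `∃ N`-clause as hypothesis.

Honest framing: OURS, composition only; after this file census (iii) of the `δ`-descent reads: kernel theorems ✓ for (S1), (S2) and the descent itself; remaining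
(S3) «near ⟹ `Φ ∈ 𝔫^μ` at `η″`» [XS, ✓ `map_mem_maximalIdeal_pow_of_surjective` + the definition of near], (S4) [definitional], the comparison with the
cocone of ✓ `tower_face` on generators [✓ `isLocalization_of_agree_on_generators`], (M) [M], (R) = (B5′) [research].  Nothing here proves X44c, any case of
`CleanModels`, or resolution of singularities in characteristic `p`. [cite: StacksProject, Tag 0804, Tag 0BIQ] [cite: Matsumura1987, Thm. 4.1–4.3, Thm. 14.2]
[cite: CossartPiltant2008, Lemma 4.3 (5); Prop. 4.4 (proof, p. 11)] [cite: CossartJannsenSaito2020, Lemma 7.5]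
-/

noncomputable section

set_option linter.dupNamespace false -- mandated namespace of this single-conjunct summit

open IsLocalRing CategoryTheory AlgebraicGeometry Polynomial
open Literature.AlgebraicGeometry.Resolution

namespace Summit.ResolutionOfSingularities.ResolutionOfSingularities.Theorems.RadicialJung.CleanModels

universe u

/-! ## §1 The base of the tower from the point blow-up -/

section Base

variable {X₀ X₁ : Scheme.{u}} {π : X₁ ⟶ X₀} {J₀ : X₀.IdealSheafData}

set_option maxHeartbeats 800000 in
-- long statement; elaboration only
/-- **THE BASE OF THE σ-TOWER** (see the module docstring): the point blow-up `π` of the closed point `c = π x′` of a regular threefold germ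
(`(c 0, c 1, c 2) = (t, u₁, u₂)` a regular system of parameters generating `(J₀)_c`), `x′` on the strict transform of the leaf `V(c 0)`, read in a ring `A₀`
identified with `𝒪_{X_1,x′}` by `e`. [cite: StacksProject, Tag 0804, Tag 0BIQ] [cite: Matsumura1987, Thm. 14.2] [cite: CossartPiltant2008, Prop. 4.4 (proof, p. 11)] -/
theorem sigmaTower_base (hπ : IsBlowup π J₀) (x' : X₁) (hR : IsRegularLocalRing (X₀.presheaf.stalk (π x')))
    (c : Fin 3 → X₀.presheaf.stalk (π x'))
    (hz : Ideal.span (Set.range (Fin.append c (Fin.elim0 : Fin 0 → X₀.presheaf.stalk (π x')))) = maximalIdeal (X₀.presheaf.stalk (π x')))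
    (hdim : ringKrullDim (X₀.presheaf.stalk (π x')) = ((3 + 0 : ℕ) : WithBot ℕ∞))
    (hcJ : Ideal.span (Set.range c) = stalkIdeal J₀ (π x'))
    (hL : (π.stalkMap x').hom (c 0) ∈ (stalkIdeal J₀ (π x')).map (π.stalkMap x').hom * maximalIdeal (X₁.presheaf.stalk x'))
    (hJ0 : (stalkIdeal J₀ (π x')).map (π.stalkMap x').hom ≠ ⊥)
    {A₀ : Type u} [CommRing A₀] [IsLocalRing A₀] (e : X₁.presheaf.stalk x' ≃+* A₀) :
    ∃ (i i₂ : Fin 3) (uf : Fin 3 → X₁.presheaf.stalk x'), i ≠ 0 ∧ i₂ ≠ 0 ∧ i₂ ≠ i ∧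
      (∀ k, (π.stalkMap x').hom (c k) = (π.stalkMap x').hom (c i) * uf k) ∧ uf i = 1 ∧ uf 0 ∈ maximalIdeal (X₁.presheaf.stalk x') ∧
      IsRsopPart ![e (uf 0), e ((π.stalkMap x').hom (c i))] ∧
      IsLocalRing (A₀ ⧸ Ideal.span (Set.range ![e (uf 0), e ((π.stalkMap x').hom (c i))])) ∧
      (∀ (K : Type u) [CommRing K] [Algebra K (X₀.presheaf.stalk (π x') ⧸ Ideal.span (Set.range c))] (M₀ : Submonoid K)
        [IsLocalization M₀ (X₀.presheaf.stalk (π x') ⧸ Ideal.span (Set.range c))]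
        (inst₀ : Algebra K[X] (A₀ ⧸ Ideal.span (Set.range ![e (uf 0), e ((π.stalkMap x').hom (c i))]))),
        (∀ (g : K) (r : X₀.presheaf.stalk (π x')), Ideal.Quotient.mk _ r = algebraMap K (X₀.presheaf.stalk (π x') ⧸ Ideal.span (Set.range c)) g →
          @algebraMap K[X] (A₀ ⧸ Ideal.span (Set.range ![e (uf 0), e ((π.stalkMap x').hom (c i))])) _ _ inst₀ (C g) =
            Ideal.Quotient.mk _ (e ((π.stalkMap x').hom r))) →
        @algebraMap K[X] (A₀ ⧸ Ideal.span (Set.range ![e (uf 0), e ((π.stalkMap x').hom (c i))])) _ _ inst₀ Polynomial.X =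
          Ideal.Quotient.mk _ (e (uf i₂)) →
        ∃ N : Submonoid K[X], @IsLocalization K[X] _ N (A₀ ⧸ Ideal.span (Set.range ![e (uf 0), e ((π.stalkMap x').hom (c i))])) _ inst₀) := by
  obtain ⟨i, i₂, uf, hi0, hi₂0, hi₂i, hrel, hufi, ht', -, hloc, hX⟩ := exists_pointStep_of_isBlowup hπ x' hR c hz hdim hcJ hL hJ0
  have hrs := isRsopPart_pair_of_isBlowup hπ x' hR c Fin.elim0 hz hdim hcJ i uf hrel 0 ht'
  -- the ideal transport along `e`
  have hI : Ideal.span (Set.range ![e (uf 0), e ((π.stalkMap x').hom (c i))]) =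
      (Ideal.span {(π.stalkMap x').hom (c i), uf 0}).map (e : X₁.presheaf.stalk x' →+* A₀) :=
    (map_span_pair_eq_span_range e _ _ _ _ rfl rfl).symm
  set eQ := Ideal.quotientEquiv _ _ e hI with heQ
  have heQsymm : ∀ a, eQ.symm (Ideal.Quotient.mk _ a) = Ideal.Quotient.mk _ (e.symm a) := fun a => Ideal.quotientEquiv_symm_mk _ _ e hI a
  refine ⟨i, i₂, uf, hi0, hi₂0, hi₂i, hrel, hufi, ht', ?_, ?_, ?_⟩
  · -- IsRsopPart transported
    have h := IsRsopPart.map_ringEquiv e hrs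
    have heq : (e : X₁.presheaf.stalk x' → A₀) ∘ ![uf 0, (π.stalkMap x').hom (c i)] = ![e (uf 0), e ((π.stalkMap x').hom (c i))] := by
      funext a; fin_cases a <;> simp
    rwa [heq] at h
  · haveI := hloc; exact eQ.isLocalRing
  · intro K _ _ M₀ _ inst₀ hKC hKX
    letI instS : Algebra K[X] (X₁.presheaf.stalk x' ⧸ Ideal.span {(π.stalkMap x').hom (c i), uf 0}) :=
      ((eQ.symm : _ →+* _).comp (@algebraMap K[X] (A₀ ⧸ Ideal.span (Set.range ![e (uf 0), e ((π.stalkMap x').hom (c i))])) _ _ inst₀)).toAlgebra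
    have halgS : ∀ q : K[X], algebraMap K[X] (X₁.presheaf.stalk x' ⧸ Ideal.span {(π.stalkMap x').hom (c i), uf 0}) q =
        eQ.symm (@algebraMap K[X] (A₀ ⧸ Ideal.span (Set.range ![e (uf 0), e ((π.stalkMap x').hom (c i))])) _ _ inst₀ q) := fun q => rfl
    obtain ⟨N, hN⟩ := hX K M₀ instS (fun g r hgr => by rw [halgS, hKC g r hgr, heQsymm, e.symm_apply_apply])
      (by rw [halgS, hKX, heQsymm, e.symm_apply_apply])
    let eQa : (X₁.presheaf.stalk x' ⧸ Ideal.span {(π.stalkMap x').hom (c i), uf 0}) ≃ₐ[K[X]]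
        (A₀ ⧸ Ideal.span (Set.range ![e (uf 0), e ((π.stalkMap x').hom (c i))])) :=
      { eQ with
        commutes' := fun q => by
          change eQ (algebraMap K[X] _ q) = _
          rw [halgS, RingEquiv.apply_symm_apply] }
    exact ⟨N, @IsLocalization.isLocalization_of_algEquiv K[X] _ N _ _ _ _ _ inst₀ hN eQa⟩

end Base

/-! ## §2 The top of the tower: `IsLocalization.AtPrime` at the births and at the generic point of the near curve -/

section Top

variable {k : Type u} [Field k] {S : Type u} [CommRing S] [IsLocalRing S] [Algebra (k[X])[X] S]

/-- **At a birth `c′ ∈ Γ″`**: the `∃ N, IsLocalization N S` clause of ✓ `sigmaTower` for `S = 𝒪_{E,c′}` with its chained `κ[u][T]`-structure, plus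
`P(u) ∈ 𝔫_S` and `T + λ ∈ 𝔫_S` (the point lies on `Γ″`, census (S4)), give `IsLocalization.AtPrime S (P, T + λ)`. [cite: Matsumura1987, Thm. 4.1–4.3] -/
theorem atPrime_span_pair_of_exists_isLocalization (hN : ∃ N : Submonoid (k[X])[X], IsLocalization N S) (P lam : k[X]) (hP : Prime P)
    (h1 : algebraMap (k[X])[X] S (C P) ∈ maximalIdeal S) (h2 : algebraMap (k[X])[X] S (X + C lam) ∈ maximalIdeal S)
    [(Ideal.span ({C P, X + C lam} : Set (k[X])[X])).IsPrime] :
    IsLocalization.AtPrime S (Ideal.span ({C P, X + C lam} : Set (k[X])[X])) := by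
  obtain ⟨N, hN⟩ := hN
  exact isLocalizationAtPrime_span_pair_of_mem P lam N hP h1 h2

/-- **At the generic point `η″` of the near curve**: the `∃ N`-clause plus «every non-zero `g(u)` is a unit» and «`𝔫_S ∩ κ[u][T] ≠ 0`» give a prime `π`
with `𝔫_S ∩ κ[u][T] = (π)` and `IsLocalization.AtPrime S (π)`. [cite: Matsumura1987, Thm. 4.1–4.3, Thm. 5.1] -/
theorem exists_prime_atPrime_of_exists_isLocalization (hN : ∃ N : Submonoid (k[X])[X], IsLocalization N S)
    (hC : ∀ g : k[X], g ≠ 0 → IsUnit (algebraMap (k[X])[X] S (C g))) (hne : (maximalIdeal S).comap (algebraMap (k[X])[X] S) ≠ ⊥) :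
    ∃ (π : (k[X])[X]) (hπ : Prime π), (maximalIdeal S).comap (algebraMap (k[X])[X] S) = Ideal.span {π} ∧
      @IsLocalization.AtPrime _ _ S _ _ (Ideal.span {π}) ((Ideal.span_singleton_prime hπ.ne_zero).mpr hπ) := by
  obtain ⟨N, hN⟩ := hN
  obtain ⟨π, hπ, hAt⟩ := exists_prime_isLocalizationAtPrime_span N hC hne
  haveI : (Ideal.span ({π} : Set (k[X])[X])).IsPrime := (Ideal.span_singleton_prime hπ.ne_zero).mpr hπ
  haveI := hAt
  exact ⟨π, hπ, comap_maximalIdeal_of_isLocalization π S, hAt⟩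

/-- **STEP 1 at `η″` from the tower**: ✓ `exists_successor_of_isLocalization` with its localization instance produced from the `∃ N`-clause of ✓ `sigmaTower`
(`S = 𝒪_{E,η″}` with the chained structure), the units hypothesis and `ρΦ ∈ 𝔫^μ` (census (S3)).  Conclusion: the near curve is `π = a(T + λ)` with
`Φ = c(T + λ)^μ`, `deg λ ≤ δ`, `deg λ′ ≤ δ − 2`, and `𝔫_S ∩ κ[u][T] = (π)`. [cite: CossartPiltant2008, Lemma 4.3 (5); Prop. 4.4 (proof, p. 11)] -/
theorem exists_successor_of_exists_isLocalization (hN : ∃ N : Submonoid (k[X])[X], IsLocalization N S)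
    (hCu : ∀ g : k[X], g ≠ 0 → IsUnit (algebraMap (k[X])[X] S (C g))) (hne : (maximalIdeal S).comap (algebraMap (k[X])[X] S) ≠ ⊥)
    {Φ : (k[X])[X]} {μ δ : ℕ} (hμ : 1 ≤ μ) (hdeg : Φ.natDegree ≤ μ) {c : k} (hc : c ≠ 0)
    (htop : Φ.coeff μ = C c) (hC0 : (Φ.coeff 0).natDegree ≤ μ * δ) (hδ : (δ : k) = 0)
    (hΦ : algebraMap (k[X])[X] S Φ ∈ maximalIdeal S ^ μ) :
    ∃ (π : (k[X])[X]) (a : k) (lam : k[X]), Prime π ∧ (maximalIdeal S).comap (algebraMap (k[X])[X] S) = Ideal.span {π} ∧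
      a ≠ 0 ∧ π = C (C a) * (X + C lam) ∧ Φ = C (C c) * (X + C lam) ^ μ ∧ lam.natDegree ≤ δ ∧
      (derivative lam).natDegree ≤ δ - 2 := by
  obtain ⟨π, hπ, hcomap, hAt⟩ := exists_prime_atPrime_of_exists_isLocalization hN hCu hne
  haveI : (Ideal.span ({π} : Set (k[X])[X])).IsPrime := (Ideal.span_singleton_prime hπ.ne_zero).mpr hπ
  haveI := hAt
  obtain ⟨a, lam, ha, hπeq, hΦeq, hlam, hlam'⟩ := exists_successor_of_isLocalization hμ hdeg hc htop hC0 hδ hπ S hΦ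
  exact ⟨π, a, lam, hπ, hcomap, ha, hπeq, hΦeq, hlam, hlam'⟩

variable (p : ℕ) [Fact p.Prime] [CharP k p]
variable {ι : Type*} (s : Finset ι) (Si : ι → Type u) [∀ i, CommRing (Si i)] [∀ i, Algebra (k[X])[X] (Si i)] [∀ i, IsLocalRing (Si i)]

/-- **STEP 2 at the births from the tower**: ✓ `birth_descent_of_isLocalization` with its localization instances produced from the `∃ N`-clauses of
✓ `sigmaTower` at the births (`S_i = 𝒪_{E,c′_i}` with the chained structure) and the (S4) facts `P_i(u), T + λ ∈ 𝔫_{S_i}`.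
[cite: CossartPiltant2008, Prop. 4.4 (proof, p. 11)] [cite: CossartPiltant2009, ch.1 II.5.3.2 (i)] -/
theorem birth_descent_of_exists_isLocalization {c : k} (hc : c ≠ 0) {a₀ : k} (ha₀ : a₀ ≠ 0) (lam : k[X]) {μ δ : ℕ} (hμ : 0 < μ)
    (hlam : lam.natDegree ≤ δ) (hδ : (δ : k) = 0) (hlam' : derivative lam ≠ 0)
    (P : ι → k[X]) (hP : ∀ i, Prime (P i)) (hne : ∀ i ∈ s, ∀ j ∈ s, i ≠ j → ¬ P i ∣ P j)
    [∀ i, (Ideal.span ({C (P i), X + C lam} : Set (k[X])[X])).IsPrime]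
    (hN : ∀ i, ∃ N : Submonoid (k[X])[X], IsLocalization N (Si i))
    (h1 : ∀ i, algebraMap (k[X])[X] (Si i) (C (P i)) ∈ maximalIdeal (Si i))
    (h2 : ∀ i, algebraMap (k[X])[X] (Si i) (X + C lam) ∈ maximalIdeal (Si i))
    (G : ∀ i, Si i) (d' : ι → ℕ) (hd'1 : ∀ i ∈ s, 1 ≤ d' i)
    (hw𝔫 : ∀ i ∈ s, algebraMap (k[X])[X] (Si i) (C (C a₀) * X) - G i ^ p ∈ maximalIdeal (Si i))
    (hf : ∀ i ∈ s, algebraMap (k[X])[X] (Si i) (C (C c) * (X + C lam) ^ μ) ∈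
      Ideal.span {algebraMap (k[X])[X] (Si i) (C (C a₀) * X) - G i ^ p} ⊔ maximalIdeal (Si i) ^ (μ * d' i)) :
    (∑ i ∈ s, (d' i - 1) * (P i).natDegree ≤ δ - 2) ∧ ∀ i ∈ s, d' i ≤ δ - 1 := by
  haveI : ∀ i, IsLocalization.AtPrime (Si i) (Ideal.span ({C (P i), X + C lam} : Set (k[X])[X])) := fun i =>
    atPrime_span_pair_of_exists_isLocalization (hN i) (P i) lam (hP i) (h1 i) (h2 i)
  exact birth_descent_of_isLocalization p s Si hc ha₀ lam hμ hlam hδ hlam' P hP hne G d' hd'1 hw𝔫 hf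

end Top

end Summit.ResolutionOfSingularities.ResolutionOfSingularities.Theorems.RadicialJung.CleanModels

end
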